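import Mathlib.Algebra.BigOperators.Finprod
import Mathlib.MeasureTheory.Integral.Bochner.Set
import Literature.MathematicalPhysics.KineticTheory.HardSphereEuler
import HarnessLib

/-!
# The reweighted odd contact statistic and the fixed-time collision-tube functional

Topic `Literature/MathematicalPhysics/KineticTheory` (definition item `defn-CollisionTubeFunctional`,
wanted by crux `stmt-AtomisticToContinuum-13078`, `JParityClosure.OddContactSymmetry`).  Tree home
for the vocabulary of the crux line `equilibrium-rung-mean-variance`: four explicit real-valued
functionals of a hard-sphere configuration on the flat torus `𝕋³` at fixed reduced density `σ`
(`N + 1` spheres of diameter `ε = hsDiameter σ N`, `HardSphereEuler.lean`), built only from the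
library's hard-sphere prelude (`HardSphereFlow`, `collisionTimes`, `empiricalMeasure`,
`localMaxwellian`, `reflectVel`, `Torus.geometry`/`sepVec`, `localGibbsLaw`).  The bodies are
copied verbatim from the line's skeleton so that its registered stubs can be stated from
`Theorems/` files (a `Lines/` file is never imported).

* `oddStat σ N Φ τ χ g Ψ r ϑ z` — the crux statistic `D(z) = K_N[χ g Ψ (1 + e^{−F})](z)`: the
  `ε/(N+1)`-weighted sum over the collision times `s ∈ [0, τ]` of the trajectory `s ↦ Φ.flow s z`
  and over the ordered contact pairs `(i, j)` (`‖sepVec xᵢ xⱼ‖ = ε`) of the mark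
  `χ(s, xᵢ) · g(σ³ ρ_r(xᵢ)) · Ψ(ε⁻¹ sepVec xᵢ xⱼ, vᵢ′, vⱼ′) · (1 + e^{−F})`, where
  `ρ_r`, `h = h_{r,ϑ}` are the empirical density and one-particle law mollified at space scale `r`
  (cone kernel `bx`) and velocity scale `ϑ` (Gaussian), `(vᵢ′, vⱼ′) = reflectVel (sepVec xᵢ xⱼ) (vᵢ, vⱼ)`
  and `F = log h(vᵢ′) + log h(vⱼ′) − log h(vᵢ) − log h(vⱼ)` is the surprisal jump of the collision.
  This is literally the `let`-chain of the route declaration `OddContactSymmetry` for one `N` and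
  one flow, so the crux reads `… localGibbsLaw … {z | η < |oddStat σ N (Φ N) τ χ g Ψ r ϑ z|} ≤ δ`
  by `Iff.rfl`.
* `oddStatTrunc … L z` — the same with the reweighting truncated, `min (1 + e^{−F}) L`.
* `tubeStat σ N χ g Ψ r ϑ L κ t z` — the **fixed-time collision-tube functional** `A_t`: Boltzmann's
  collision cylinder read on ONE configuration.  For an ordered pair put `q = sepVec xᵢ xⱼ`,
  `w = vᵢ − vⱼ`; under the pair's free flight the relative position is `q + s w`, and with
  `a = ‖w‖²`, `b = ⟪q, w⟫`, `c = ‖q‖² − ε²` the first contact time is the smaller root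
  `t_h = (−b − √(b² − ac))/a` of `a s² + 2 b s + c = 0`.  The pair is in the tube iff it is apart
  (`ε < ‖q‖`), approaching (`b < 0`), reaches contact (`ac ≤ b²`) within the flight-time window
  `t_h ≤ κ ε`; the predicted contact normal is `n_h = ε⁻¹ (q + t_h w)`, and the mark
  `χ(t, xᵢ) g(σ³ρ_r(xᵢ)) Ψ(n_h, vᵢ, vⱼ) min(1 + e^{−F̃}, L)` is summed with weight `((N+1) κ)⁻¹`
  (so that a collision preceded by a free flight of duration `κ ε` contributes `ε/(N+1)` to
  `∫ A_t dt`, the weight of `oddStat`).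
* `tubeTimeStat σ N Φ τ χ g Ψ r ϑ L κ z = ∫_{t ∈ [0, τ]} tubeStat … t (Φ.flow t z) dt`.

API: `tubeTimeStat_def`, the elementary sup bound `abs_tubeStat_le`
(`|A_t| ≤ ((N+1)κ)⁻¹ (N+1)² C_χ C_g C_Ψ L`) and `abs_tubeTimeStat_le`.

## References

* C. Cercignani, R. Illner, M. Pulvirenti, *The Mathematical Theory of Dilute Gases* (1994), §2.2
  (Boltzmann's argument: the molecules with relative velocity `V` hitting the surface element `a² dn`
  of the protection sphere during `(t, t + dt)` fill the collision cylinder of height `|V · n| dt`;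
  pre-collisional hemisphere `V · n < 0`).  [CIPDiluteGases1994]
* I. Gallagher, L. Saint-Raymond, B. Texier, *From Newton to Boltzmann* (2013), Part II Ch. 4, §4.1
  (the hard-sphere flow: free flow, elastic reflection at `|xᵢ − xⱼ| = ε` with
  `νⁱʲ = (xᵢ − xⱼ)/|xᵢ − xⱼ|`, pre-collisional iff `νⁱʲ · (vᵢ − vⱼ) < 0`; Lemma 4.1.1: the set of
  configurations with a collision in a time window `[0, δ]`).  [GallagherSaintRaymondTexier2013]
* H. Spohn, *Large Scale Dynamics of Interacting Particles* (1991), Part I Ch. 3 (local equilibrium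
  states, Euler scaling of Newtonian particles).  [Spohn1991]

## Not here

The line's five stubs (reweighting tightness, cylinder pull-back, mean parity, fixed-time variance,
`L² →` probability) and their composition are problem-side statements
(`Summits/AtomisticToContinuum/HydrodynamicLimit/…`); no measurability or limit statement is made in
this file — these are pure definitions plus an elementary bound.
-/

noncomputable section

open scoped BigOperators Classical InnerProductSpace ENNReal
open Set MeasureTheory
open Literature.Analysis.FluidPDE

namespace Literature.MathematicalPhysics.KineticTheory

/-! ## The crux statistic and its truncation (verbatim `let`-chain of `OddContactSymmetry`) -/

/-- The crux statistic `D(z) = K_N[χ g Ψ (1+e^{−F})](z)` of `JParityClosure.OddContactSymmetry`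
for one particle number `N` and one hard-sphere flow `Φ` on `𝕋³` at reduced diameter `σ`
(the `let`-chain of the route declaration, verbatim, with `(Φ N).flow ↦ Φ.flow`): the
`ε/(N+1)`-weighted sum (`ε = hsDiameter σ N`) over the collision times `s ∈ [0, τ]` of the
trajectory `s ↦ Φ.flow s z` and over the ordered contact pairs `(i, j)`, `‖sepVec xᵢ xⱼ‖ = ε`, of
the reweighted mark `χ(s, xᵢ) · g(σ³ρ_r(xᵢ)) · Ψ(ε⁻¹ sepVec xᵢ xⱼ, vᵢ′, vⱼ′) · (1 + e^{−F})`, where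
`ρ_r = ρm` / `h = hm` are the `r`-mollified empirical density / `(r, ϑ)`-mollified empirical
one-particle law, `(vᵢ′, vⱼ′) = reflectVel (sepVec xᵢ xⱼ) (vᵢ, vⱼ)` (`pv`) and
`F = log h(vᵢ′) + log h(vⱼ′) − log h(vᵢ) − log h(vⱼ)` (all read at time `s`, position `xᵢ`).
The finsum over collision times takes the junk value `0` when infinitely many collision times lie in
`[0, τ]` (excluded on the good set of the flow). [folklore] -/
def oddStat (σ : ℝ) (N : ℕ)
    (Φ : HardSphereFlow (Torus.geometry (Fin 3)) (hsDiameter σ N) (N + 1))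
    (τ : ℝ) (χ : ℝ × UnitAddTorus (Fin 3) → ℝ) (g : ℝ → ℝ)
    (Ψ : EuclideanSpace ℝ (Fin 3) × EuclideanSpace ℝ (Fin 3) × EuclideanSpace ℝ (Fin 3) → ℝ)
    (r ϑ : ℝ) (z : Config (N + 1) (Fin 3) T3) : ℝ :=
  let ε := Literature.MathematicalPhysics.KineticTheory.hsDiameter σ N
  let G := Literature.Analysis.FluidPDE.Torus.geometry (Fin 3)
  let γ := fun z (s : ℝ) => Φ.flow s z
  let bx : UnitAddTorus (Fin 3) → UnitAddTorus (Fin 3) → ℝ := fun x y => 3 / (Real.pi * r ^ 3) * max (1 - Literature.Analysis.FluidPDE.Torus.euclidDist x y / r) 0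
  let ρm := fun z s (x₀ : UnitAddTorus (Fin 3)) => ∫ q, bx q.1 x₀ ∂(Literature.Analysis.FluidPDE.empiricalMeasure (γ z s))
  let hm := fun z s (x₀ : UnitAddTorus (Fin 3)) (v : EuclideanSpace ℝ (Fin 3)) => ∫ q, bx q.1 x₀ * Literature.Analysis.FluidPDE.localMaxwellian 1 (ϑ ^ 2) v q.2 ∂(Literature.Analysis.FluidPDE.empiricalMeasure (γ z s))
  let pv := fun z s (i j : Fin (N + 1)) => Literature.Analysis.FluidPDE.reflectVel (G.sepVec (γ z s i).1 (γ z s j).1) ((γ z s i).2, (γ z s j).2)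
  let F := fun z s (i j : Fin (N + 1)) => Real.log (hm z s (γ z s i).1 (pv z s i j).1) + Real.log (hm z s (γ z s i).1 (pv z s i j).2) - Real.log (hm z s (γ z s i).1 (γ z s i).2) - Real.log (hm z s (γ z s i).1 (γ z s j).2)
  let Kc := fun (Fn : Literature.Analysis.FluidPDE.Config (N + 1) (Fin 3) Literature.MathematicalPhysics.KineticTheory.T3 → ℝ → Fin (N + 1) → Fin (N + 1) → ℝ) z => ε / (N + 1 : ℝ) * ∑ᶠ (s : ℝ) (_ : s ∈ Literature.Analysis.FluidPDE.collisionTimes G ε (γ z) ∩ Set.Icc 0 τ), ∑ i : Fin (N + 1), ∑ j : Fin (N + 1), (if i ≠ j ∧ ‖G.sepVec (γ z s i).1 (γ z s j).1‖ = ε then Fn z s i j else 0)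
  let D := fun z => Kc (fun z s i j => χ (s, (γ z s i).1) * g (σ ^ 3 * ρm z s (γ z s i).1) * (Ψ (ε⁻¹ • G.sepVec (γ z s i).1 (γ z s j).1, (pv z s i j).1, (pv z s i j).2) * (1 + Real.exp (-F z s i j)))) z
  D z

/-- The TRUNCATED crux statistic `D_L(z) = K_N[χ g Ψ min(1+e^{−F}, L)](z)`: the same `let`-chain
as `oddStat` with the reweighting factor `1 + e^{−F}` replaced by `min (1 + e^{−F}) L`
(truncation of the reweighting at level `L`; `D − D_L = K_N[χ g Ψ (1 + e^{−F} − L)₊]`).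
[folklore] -/
def oddStatTrunc (σ : ℝ) (N : ℕ)
    (Φ : HardSphereFlow (Torus.geometry (Fin 3)) (hsDiameter σ N) (N + 1))
    (τ : ℝ) (χ : ℝ × UnitAddTorus (Fin 3) → ℝ) (g : ℝ → ℝ)
    (Ψ : EuclideanSpace ℝ (Fin 3) × EuclideanSpace ℝ (Fin 3) × EuclideanSpace ℝ (Fin 3) → ℝ)
    (r ϑ L : ℝ) (z : Config (N + 1) (Fin 3) T3) : ℝ :=
  let ε := Literature.MathematicalPhysics.KineticTheory.hsDiameter σ N
  let G := Literature.Analysis.FluidPDE.Torus.geometry (Fin 3)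
  let γ := fun z (s : ℝ) => Φ.flow s z
  let bx : UnitAddTorus (Fin 3) → UnitAddTorus (Fin 3) → ℝ := fun x y => 3 / (Real.pi * r ^ 3) * max (1 - Literature.Analysis.FluidPDE.Torus.euclidDist x y / r) 0
  let ρm := fun z s (x₀ : UnitAddTorus (Fin 3)) => ∫ q, bx q.1 x₀ ∂(Literature.Analysis.FluidPDE.empiricalMeasure (γ z s))
  let hm := fun z s (x₀ : UnitAddTorus (Fin 3)) (v : EuclideanSpace ℝ (Fin 3)) => ∫ q, bx q.1 x₀ * Literature.Analysis.FluidPDE.localMaxwellian 1 (ϑ ^ 2) v q.2 ∂(Literature.Analysis.FluidPDE.empiricalMeasure (γ z s))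
  let pv := fun z s (i j : Fin (N + 1)) => Literature.Analysis.FluidPDE.reflectVel (G.sepVec (γ z s i).1 (γ z s j).1) ((γ z s i).2, (γ z s j).2)
  let F := fun z s (i j : Fin (N + 1)) => Real.log (hm z s (γ z s i).1 (pv z s i j).1) + Real.log (hm z s (γ z s i).1 (pv z s i j).2) - Real.log (hm z s (γ z s i).1 (γ z s i).2) - Real.log (hm z s (γ z s i).1 (γ z s j).2)
  let Kc := fun (Fn : Literature.Analysis.FluidPDE.Config (N + 1) (Fin 3) Literature.MathematicalPhysics.KineticTheory.T3 → ℝ → Fin (N + 1) → Fin (N + 1) → ℝ) z => ε / (N + 1 : ℝ) * ∑ᶠ (s : ℝ) (_ : s ∈ Literature.Analysis.FluidPDE.collisionTimes G ε (γ z) ∩ Set.Icc 0 τ), ∑ i : Fin (N + 1), ∑ j : Fin (N + 1), (if i ≠ j ∧ ‖G.sepVec (γ z s i).1 (γ z s j).1‖ = ε then Fn z s i j else 0)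
  let D := fun z => Kc (fun z s i j => χ (s, (γ z s i).1) * g (σ ^ 3 * ρm z s (γ z s i).1) * (Ψ (ε⁻¹ • G.sepVec (γ z s i).1 (γ z s j).1, (pv z s i j).1, (pv z s i j).2) * min (1 + Real.exp (-F z s i j)) L)) z
  D z

/-! ## The fixed-time collision-tube functional (Boltzmann's collision cylinder on one configuration) -/

/-- **The fixed-time tube functional `A_t`** (`tubeStat σ N χ g Ψ r ϑ L κ t z`).  For a configuration
`z` of `N + 1` spheres of diameter `ε = hsDiameter σ N` on `𝕋³` and an ordered pair `(i, j)`, `i ≠ j`,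
put `q = sepVec xᵢ xⱼ` (minimal image of `xᵢ − xⱼ`) and `w = vᵢ − vⱼ`, so that under the pair's
FREE flight the relative position is `q + s·w`; with `a = ‖w‖²`, `b = ⟪q, w⟫`, `c = ‖q‖² − ε²` the
first contact time is `t_h = (−b − √(b² − ac))/a` (smaller root of `a s² + 2 b s + c = 0`).  The pair
is IN THE TUBE iff it is apart (`ε < ‖q‖`), approaching (`b < 0`), reaches contact (`ac ≤ b²`)
within the flight-time window (`t_h ≤ κ·ε`) — Boltzmann's collision cylinder of height `|w·n| κε`
(CIP 1994 §2.2) read on the configuration; the predicted unit contact normal is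
`n_h = ε⁻¹(q + t_h w)` and the predicted post-collisional velocities are `reflectVel n_h (vᵢ, vⱼ)`.
The functional is `((N+1)κ)⁻¹ Σ_{(i,j) in tube}` of the crux's mark read at the PREDICTED collision
with CURRENT positions/fields: `χ(t, xᵢ) · g(σ³ρ_r(xᵢ)) · Ψ(n_h, vᵢ, vⱼ) · min(1 + e^{−F̃}, L)`,
`F̃ = log h(vᵢ) + log h(vⱼ) − log h(vᵢ′) − log h(vⱼ′)` with `h = hm` the `(r, ϑ)`-mollified empirical
one-particle law of `z` at `xᵢ`.  The weight `((N+1)κ)⁻¹ = ε/((N+1)·κε)` makes each collision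
preceded by a free pair flight of duration `κε` contribute exactly `ε/(N+1)` (the weight of
`oddStat`) to `∫ A_t dt`.  Junk values: `κ = 0` gives `0` (`0⁻¹ = 0`); a pair at rest relative to
each other (`a = 0`) is never approaching.  Sup bound: `abs_tubeStat_le`. [folklore] -/
def tubeStat (σ : ℝ) (N : ℕ) (χ : ℝ × UnitAddTorus (Fin 3) → ℝ) (g : ℝ → ℝ)
    (Ψ : EuclideanSpace ℝ (Fin 3) × EuclideanSpace ℝ (Fin 3) × EuclideanSpace ℝ (Fin 3) → ℝ)
    (r ϑ L κ t : ℝ) (z : Config (N + 1) (Fin 3) T3) : ℝ :=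
  let ε := hsDiameter σ N
  let G := Torus.geometry (Fin 3)
  let bx : UnitAddTorus (Fin 3) → UnitAddTorus (Fin 3) → ℝ :=
    fun x y => 3 / (Real.pi * r ^ 3) * max (1 - Torus.euclidDist x y / r) 0
  let ρm : UnitAddTorus (Fin 3) → ℝ := fun x₀ => ∫ q, bx q.1 x₀ ∂(empiricalMeasure z)
  let hm : UnitAddTorus (Fin 3) → EuclideanSpace ℝ (Fin 3) → ℝ :=
    fun x₀ v => ∫ q, bx q.1 x₀ * localMaxwellian 1 (ϑ ^ 2) v q.2 ∂(empiricalMeasure z)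
  let q : Fin (N + 1) → Fin (N + 1) → EuclideanSpace ℝ (Fin 3) := fun i j => G.sepVec (z i).1 (z j).1
  let w : Fin (N + 1) → Fin (N + 1) → EuclideanSpace ℝ (Fin 3) := fun i j => (z i).2 - (z j).2
  let a : Fin (N + 1) → Fin (N + 1) → ℝ := fun i j => ‖w i j‖ ^ 2
  let b : Fin (N + 1) → Fin (N + 1) → ℝ := fun i j => ⟪q i j, w i j⟫_ℝ
  let c : Fin (N + 1) → Fin (N + 1) → ℝ := fun i j => ‖q i j‖ ^ 2 - ε ^ 2
  let th : Fin (N + 1) → Fin (N + 1) → ℝ := fun i j => (-b i j - Real.sqrt (b i j ^ 2 - a i j * c i j)) / a i j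
  let nh : Fin (N + 1) → Fin (N + 1) → EuclideanSpace ℝ (Fin 3) := fun i j => ε⁻¹ • (q i j + th i j • w i j)
  let pw : Fin (N + 1) → Fin (N + 1) → EuclideanSpace ℝ (Fin 3) × EuclideanSpace ℝ (Fin 3) :=
    fun i j => reflectVel (nh i j) ((z i).2, (z j).2)
  let F : Fin (N + 1) → Fin (N + 1) → ℝ := fun i j =>
    Real.log (hm (z i).1 (z i).2) + Real.log (hm (z i).1 (z j).2) -
      Real.log (hm (z i).1 (pw i j).1) - Real.log (hm (z i).1 (pw i j).2)
  ((N + 1 : ℝ) * κ)⁻¹ * ∑ i : Fin (N + 1), ∑ j : Fin (N + 1),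
    (if i ≠ j ∧ ε < ‖q i j‖ ∧ b i j < 0 ∧ a i j * c i j ≤ b i j ^ 2 ∧ th i j ≤ κ * ε then
      χ (t, (z i).1) * g (σ ^ 3 * ρm (z i).1) *
        (Ψ (nh i j, (z i).2, (z j).2) * min (1 + Real.exp (-F i j)) L)
    else 0)

/-- **The time-integrated tube statistic** `T_{L,κ}(z) = ∫_{t ∈ [0,τ]} A_t(Φ_t z) dt` along the
hard-sphere flow `Φ` started at `z` (Bochner integral over `Set.Icc 0 τ` for Lebesgue measure; junk
value `0` if the integrand is not integrable, and `0` for `τ < 0`). [folklore] -/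
def tubeTimeStat (σ : ℝ) (N : ℕ)
    (Φ : HardSphereFlow (Torus.geometry (Fin 3)) (hsDiameter σ N) (N + 1))
    (τ : ℝ) (χ : ℝ × UnitAddTorus (Fin 3) → ℝ) (g : ℝ → ℝ)
    (Ψ : EuclideanSpace ℝ (Fin 3) × EuclideanSpace ℝ (Fin 3) × EuclideanSpace ℝ (Fin 3) → ℝ)
    (r ϑ L κ : ℝ) (z : Config (N + 1) (Fin 3) T3) : ℝ :=
  ∫ t in Set.Icc (0 : ℝ) τ, tubeStat σ N χ g Ψ r ϑ L κ t (Φ.flow t z)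

/-! ## API -/

section API

variable {σ : ℝ} {N : ℕ} {χ : ℝ × UnitAddTorus (Fin 3) → ℝ} {g : ℝ → ℝ}
  {Ψ : EuclideanSpace ℝ (Fin 3) × EuclideanSpace ℝ (Fin 3) × EuclideanSpace ℝ (Fin 3) → ℝ}
  {r ϑ L κ : ℝ}

/-- Unfolding of `tubeTimeStat` (definitional). [folklore] -/
theorem tubeTimeStat_def (Φ : HardSphereFlow (Torus.geometry (Fin 3)) (hsDiameter σ N) (N + 1))
    (τ : ℝ) (z : Config (N + 1) (Fin 3) T3) :
    tubeTimeStat σ N Φ τ χ g Ψ r ϑ L κ z =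
      ∫ t in Set.Icc (0 : ℝ) τ, tubeStat σ N χ g Ψ r ϑ L κ t (Φ.flow t z) :=
  rfl

/-- Elementary bound for a doubly indexed sum over `Fin (N+1) × Fin (N+1)` scaled by a nonnegative
constant: `|c Σᵢ Σⱼ sᵢⱼ| ≤ c (N+1)² B` when `|sᵢⱼ| ≤ B`. [folklore] -/
private theorem abs_const_mul_sum_sum_le {c B : ℝ} (hc : 0 ≤ c)
    (s : Fin (N + 1) → Fin (N + 1) → ℝ) (hs : ∀ i j, |s i j| ≤ B) :
    |c * ∑ i, ∑ j, s i j| ≤ c * ((N + 1 : ℝ) ^ 2 * B) := by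
  rw [abs_mul, abs_of_nonneg hc]
  refine mul_le_mul_of_nonneg_left ?_ hc
  calc |∑ i, ∑ j, s i j| ≤ ∑ i, |∑ j, s i j| := Finset.abs_sum_le_sum_abs _ _
    _ ≤ ∑ i, ∑ j, |s i j| := Finset.sum_le_sum fun i _ => Finset.abs_sum_le_sum_abs _ _
    _ ≤ ∑ _i : Fin (N + 1), ∑ _j : Fin (N + 1), B :=
        Finset.sum_le_sum fun i _ => Finset.sum_le_sum fun j _ => hs i j
    _ = (N + 1 : ℝ) ^ 2 * B := by
        simp only [Finset.sum_const, Finset.card_univ, Fintype.card_fin, nsmul_eq_mul]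
        push_cast
        ring

/-- Elementary bound for one mark `χ · g · (Ψ · m)` with `0 ≤ m ≤ L`. [folklore] -/
private theorem abs_mark_le {x₁ x₂ x₃ m C₁ C₂ C₃ L' : ℝ} (h₁ : |x₁| ≤ C₁) (h₂ : |x₂| ≤ C₂)
    (h₃ : |x₃| ≤ C₃) (hm0 : 0 ≤ m) (hmL : m ≤ L') :
    |x₁ * x₂ * (x₃ * m)| ≤ C₁ * C₂ * (C₃ * L') := by
  have hC₁ : 0 ≤ C₁ := (abs_nonneg _).trans h₁
  have hC₃ : 0 ≤ C₃ := (abs_nonneg _).trans h₃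
  have hm : |m| ≤ L' := by rwa [abs_of_nonneg hm0]
  rw [abs_mul, abs_mul, abs_mul]
  exact mul_le_mul (mul_le_mul h₁ h₂ (abs_nonneg _) hC₁) (mul_le_mul h₃ hm (abs_nonneg _) hC₃)
    (by positivity) (mul_nonneg hC₁ ((abs_nonneg _).trans h₂))

/-- **Sup bound for the tube functional.**  If `|χ(t, ·)| ≤ C_χ`, `|g| ≤ C_g`, `|Ψ| ≤ C_Ψ`,
`0 ≤ L` and `0 ≤ κ`, then `|A_t(z)| ≤ ((N+1)κ)⁻¹ · (N+1)² · C_χ C_g C_Ψ L` for every configuration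
`z`: at most `(N+1)²` ordered pairs sit in the tube, each mark is bounded by `C_χ C_g C_Ψ L`
(the truncated reweighting `min(1 + e^{−F̃}, L)` lies in `[0, L]`). [folklore] -/
theorem abs_tubeStat_le {t Cχ Cg CΨ : ℝ} (hχ : ∀ x, |χ (t, x)| ≤ Cχ) (hg : ∀ a, |g a| ≤ Cg)
    (hΨ : ∀ p, |Ψ p| ≤ CΨ) (hL : 0 ≤ L) (hκ : 0 ≤ κ) (z : Config (N + 1) (Fin 3) T3) :
    |tubeStat σ N χ g Ψ r ϑ L κ t z| ≤
      ((N + 1 : ℝ) * κ)⁻¹ * ((N + 1 : ℝ) ^ 2 * (Cχ * Cg * (CΨ * L))) := by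
  have hCχ : 0 ≤ Cχ := (abs_nonneg _).trans (hχ (z 0).1)
  have hCg : 0 ≤ Cg := (abs_nonneg _).trans (hg 0)
  have hCΨ : 0 ≤ CΨ := (abs_nonneg _).trans (hΨ 0)
  dsimp only [tubeStat]
  refine abs_const_mul_sum_sum_le (by positivity) _ fun i j => ?_
  split_ifs with h
  · exact abs_mark_le (hχ _) (hg _) (hΨ _) (le_min (by positivity) hL) (min_le_right _ _)
  · rw [abs_zero]; positivity

/-- **Bound for the time-integrated tube statistic.**  If `|A_t(Φ_t z)| ≤ B` for `t ∈ [0, τ]`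
(`0 ≤ τ`), then `|T_{L,κ}(z)| ≤ B·τ` (norm of a set integral over `Icc 0 τ`, of Lebesgue measure
`τ`; no integrability needed since the junk value `0` also obeys the bound). [folklore] -/
theorem abs_tubeTimeStat_le (Φ : HardSphereFlow (Torus.geometry (Fin 3)) (hsDiameter σ N) (N + 1))
    {τ B : ℝ} (hτ : 0 ≤ τ) (z : Config (N + 1) (Fin 3) T3)
    (hB : ∀ t ∈ Set.Icc (0 : ℝ) τ, |tubeStat σ N χ g Ψ r ϑ L κ t (Φ.flow t z)| ≤ B) :
    |tubeTimeStat σ N Φ τ χ g Ψ r ϑ L κ z| ≤ B * τ := by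
  rw [tubeTimeStat_def]
  have h := norm_setIntegral_le_of_norm_le_const (μ := volume) (s := Set.Icc (0 : ℝ) τ)
    (f := fun t => tubeStat σ N χ g Ψ r ϑ L κ t (Φ.flow t z)) (C := B) measure_Icc_lt_top
    (fun t ht => by simpa only [Real.norm_eq_abs] using hB t ht)
  simpa only [Real.norm_eq_abs, Real.volume_real_Icc_of_le hτ, sub_zero] using h

end API

end Literature.MathematicalPhysics.KineticTheory

end
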